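/-
Copyright: H21 programme, solo seat `solo-RiemannHypothesis-informed` (session 4).
-/
import Summits.RiemannHypothesis.RiemannHypothesis.Theorems.SoloInformedEffThreshold
import Summits.RiemannHypothesis.RiemannHypothesis.Theorems.SoloInformedDoubleLogWindow

/-!
# Effective double-log chain (solo-informed, T23)

T16 and T17 with their constants as DEFINITE terms: `bumpK ψ = 4·zetaDensityConst·(‖ψ″‖₁² +
‖ψ‴‖₁² + 2‖ψ⁗‖₁²) + 1` and `doubleLogC0 ψ η = max (η⁻¹ log(2Φ(−η)/Φ(η)+1))
((2η)⁻¹ log(4·bumpK ψ/(η⁴Φ(η)²)+1))` (`Φ = bumpLaplace ψ`). Proofs verbatim from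
`SoloInformedDoubleLog` / `SoloInformedDoubleLogWindow`.
-/

open MeasureTheory Complex Set Filter Topology Literature.NumberTheory.LFunctions
open scoped ContDiff ComplexConjugate

namespace Summit.RiemannHypothesis.RiemannHypothesis.Theorems

variable {ψ : ℝ → ℝ}

/-- The visibility constant of a bump `ψ`: `K(ψ) = 4·zetaDensityConst·(‖ψ″‖₁² + ‖ψ‴‖₁² + 2‖ψ⁗‖₁²) + 1`. -/
noncomputable def bumpK (ψ : ℝ → ℝ) : ℝ :=
  4 * zetaDensityConst * ((∫ s, |iteratedDeriv 2 ψ s|) ^ 2 + (∫ s, |iteratedDeriv 3 ψ s|) ^ 2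
    + 2 * (∫ s, |iteratedDeriv 4 ψ s|) ^ 2) + 1

/-- `0 < bumpK ψ`. -/
theorem bumpK_pos (ψ : ℝ → ℝ) : 0 < bumpK ψ := by
  unfold bumpK
  have := zetaDensityConst_nonneg
  positivity

/-- The double-log window offset `c₀(ψ, η) = max (η⁻¹ log(2Φ(−η)/Φ(η) + 1))
((2η)⁻¹ log(4K(ψ)/(η⁴Φ(η)²) + 1))`, `Φ = bumpLaplace ψ`. -/
noncomputable def doubleLogC0 (ψ : ℝ → ℝ) (η : ℝ) : ℝ :=
  max (Real.log (2 * bumpLaplace ψ (-η) / bumpLaplace ψ η + 1) / η)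
    (Real.log (4 * bumpK ψ / (η ^ 4 * bumpLaplace ψ η ^ 2) + 1) / (2 * η))

/-- `0 ≤ doubleLogC0 ψ η` for `η > 0`, `Φ(η) > 0`, `ψ ≥ 0`. -/
theorem doubleLogC0_nonneg (hψ0 : ∀ s, 0 ≤ ψ s) {η : ℝ} (hη : 0 < η)
    (hΦ : 0 < bumpLaplace ψ η) : 0 ≤ doubleLogC0 ψ η := by
  unfold doubleLogC0
  refine le_max_of_le_left (div_nonneg (Real.log_nonneg ?_) hη.le)
  have := bumpLaplace_nonneg hψ0 (-η)
  exact le_add_of_nonneg_left (by positivity)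

/-- **T16, effective.** The double-log visibility theorem with the definite constant `bumpK ψ`. -/
theorem weilGroundEnergy_neg_of_local_bumpDipole_eff (hψ : ContDiff ℝ ∞ ψ)
    (hsupp : tsupport ψ ⊆ Icc (-1) 1) (hψ0 : ∀ s, 0 ≤ ψ s) :
    ∀ (η γ₀ c R : ℝ), 0 < η → η < 1 / 2 → γ₀ ≠ 0 → 0 ≤ c → 1 ≤ R →
      Real.exp (c + 1) ≤ R ^ 2 →
      riemannZeta (1 / 2 + η + γ₀ * I) = 0 →
      (∀ ρ : ℂ, riemannZeta ρ = 0 → 0 ≤ ρ.re → ρ.re ≤ 1 → |ρ.im - γ₀| < R → ρ.re ≠ 1 / 2 →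
          ρ = 1 / 2 + η + γ₀ * I ∨ ρ = 1 / 2 - η + γ₀ * I) →
      bumpLaplace ψ (-η) ≤ Real.exp (η * c) * bumpLaplace ψ η →
      (bumpK ψ * Real.log (|γ₀| + 2) <
          η ^ 4 * (Real.exp (η * c) * bumpLaplace ψ η - bumpLaplace ψ (-η)) ^ 2) →
      weilGroundEnergy (c + 1) < 0 := by
  intro η γ₀ c R hη hη2 hγ hc hR hRa hζ hloc hgainpos hwin
  unfold bumpK at hwin
  have hT := weilGroundEnergy_neg_of_local_oddDipole_eff
  set A₁ : ℝ := zetaDensityConst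
  have _hA₁ : 0 < A₁ := zetaDensityConst_pos
  set N₂ : ℝ := ∫ s, |iteratedDeriv 2 ψ s| with hN₂
  set N₃ : ℝ := ∫ s, |iteratedDeriv 3 ψ s| with hN₃
  set N₄ : ℝ := ∫ s, |iteratedDeriv 4 ψ s| with hN₄
  -- the test function and its properties
  have hh : IsWeilTest (bumpDipole ψ c) := isWeilTest_bumpDipole hψ hsupp hc
  have hodd : ∀ t, bumpDipole ψ c (-t) = -bumpDipole ψ c t := bumpDipole_odd ψ c
  have hhs : tsupport (bumpDipole ψ c) ⊆ Icc (-(c + 1)) (c + 1) :=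
    tsupport_bumpDipole_subset hsupp hc
  -- the gain
  set g : ℝ := Real.exp (η * c) * bumpLaplace ψ η - bumpLaplace ψ (-η) with hg_def
  have hg0 : 0 ≤ g := sub_nonneg.mpr hgainpos
  have hgain : g ≤ ‖∫ t, bumpDipole ψ c t * cexp ((η : ℂ) * t)‖ :=
    gain_bumpDipole hψ.continuous hsupp hψ0 hη.le hc
  have hL : 0 < Real.log (|γ₀| + 2) := Real.log_pos (by linarith [abs_nonneg γ₀])
  have hgpos : 0 < g := by
    rcases hg0.lt_or_eq with h | h
    · exact h
    · exfalso
      rw [← h] at hwin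
      have : 0 < (4 * A₁ * (N₂ ^ 2 + N₃ ^ 2 + 2 * N₄ ^ 2) + 1) * Real.log (|γ₀| + 2) := by
        positivity
      linarith
  have hint_ne : ∫ t, bumpDipole ψ c t * cexp ((η : ℂ) * t) ≠ 0 := by
    intro h0
    rw [h0, norm_zero] at hgain
    linarith
  have hpos : 0 < ∫ t, ‖weilDodge 0 (bumpDipole ψ c) t‖ ^ 2 :=
    integral_norm_sq_weilDodge_zero_pos hh hη.ne' hint_ne
  -- the `c`-independent norms
  have hk1 : ∫ t, ‖weilDodge 0 (bumpDipole ψ c) t‖ ≤ 2 * N₂ := by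
    rw [weilDodge_zero_eq]
    simp only [norm_neg]
    exact integral_norm_iteratedDeriv_bumpDipole_le hψ hsupp c 2
  have hk2 : ∫ t, ‖deriv (weilDodge 0 (bumpDipole ψ c)) t‖ ≤ 2 * N₃ := by
    rw [deriv_weilDodge_zero]
    simp only [norm_neg]
    exact integral_norm_iteratedDeriv_bumpDipole_le hψ hsupp c 3
  have hk3 : ∫ t, ‖iteratedDeriv 2 (weilDodge 0 (bumpDipole ψ c)) t‖ ≤ 2 * N₄ := by
    rw [iteratedDeriv_two_weilDodge_zero]
    simp only [norm_neg]
    exact integral_norm_iteratedDeriv_bumpDipole_le hψ hsupp c 4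
  have hMloc : ((∫ t, ‖weilDodge 0 (bumpDipole ψ c) t‖) ^ 2
      + (∫ t, ‖deriv (weilDodge 0 (bumpDipole ψ c)) t‖) ^ 2)
      + 2 * Real.exp (c + 1) * (∫ t, ‖iteratedDeriv 2 (weilDodge 0 (bumpDipole ψ c)) t‖) ^ 2
          / R ^ (2 * 1) ≤ 4 * (N₂ ^ 2 + N₃ ^ 2 + 2 * N₄ ^ 2) :=
    local_majorant_arith (integral_nonneg fun _ ↦ norm_nonneg _)
      (integral_nonneg fun _ ↦ norm_nonneg _) (integral_nonneg fun _ ↦ norm_nonneg _) hk1 hk2 hk3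
      (Real.exp_pos _) (by simpa using hRa)
  have h1 : 2 * A₁ * (((∫ t, ‖weilDodge 0 (bumpDipole ψ c) t‖) ^ 2
      + (∫ t, ‖deriv (weilDodge 0 (bumpDipole ψ c)) t‖) ^ 2)
      + 2 * Real.exp (c + 1) * (∫ t, ‖iteratedDeriv 2 (weilDodge 0 (bumpDipole ψ c)) t‖) ^ 2
          / R ^ (2 * 1)) * Real.log (|γ₀| + 2)
      ≤ 2 * A₁ * (4 * (N₂ ^ 2 + N₃ ^ 2 + 2 * N₄ ^ 2)) * Real.log (|γ₀| + 2) :=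
    mul_le_mul_of_nonneg_right (mul_le_mul_of_nonneg_left hMloc (by positivity)) hL.le
  -- the zero has multiplicity ≥ 1
  have hne1 : (1 / 2 + η + γ₀ * I : ℂ) ≠ 1 := by
    intro h
    apply hγ
    have := congrArg Complex.im h
    simpa using this
  have hm1 : (1 : ℝ) ≤ (riemannZetaZeroOrder (1 / 2 + η + γ₀ * I) : ℝ) := by
    have := (riemannZetaZeroOrder_pos_iff hne1).mpr hζ
    have h1m : (1 : ℤ) ≤ riemannZetaZeroOrder (1 / 2 + η + γ₀ * I) := by omega
    exact_mod_cast h1m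
  have hG : η ^ 4 * g ^ 2 ≤
      (η ^ 2 + (0 : ℝ) ^ 2) ^ 2 * ‖∫ t, bumpDipole ψ c t * cexp ((η : ℂ) * t)‖ ^ 2 := by
    rw [show (η ^ 2 + (0 : ℝ) ^ 2) ^ 2 = η ^ 4 by ring]
    exact mul_le_mul_of_nonneg_left (pow_le_pow_left₀ hg0 hgain 2) (by positivity)
  have hP : 0 ≤ (η ^ 2 + (0 : ℝ) ^ 2) ^ 2 * ‖∫ t, bumpDipole ψ c t * cexp ((η : ℂ) * t)‖ ^ 2 := by
    positivity
  have hmP := mul_le_mul_of_nonneg_right hm1 hP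
  have h2 : 2 * A₁ * (4 * (N₂ ^ 2 + N₃ ^ 2 + 2 * N₄ ^ 2)) * Real.log (|γ₀| + 2) <
      2 * ((riemannZetaZeroOrder (1 / 2 + η + γ₀ * I) : ℝ)
        * ((η ^ 2 + (0 : ℝ) ^ 2) ^ 2 * ‖∫ t, bumpDipole ψ c t * cexp ((η : ℂ) * t)‖ ^ 2)) := by
    linarith [hwin, hG, hmP, hL]
  have key := hT (bumpDipole ψ c) (c + 1) 0 η γ₀ R 1 hh hodd (by linarith) hR hhs
    (by simpa only [Complex.ofReal_zero] using hpos) hζ (abs_lt.mpr ⟨by linarith, hη2⟩) hη.ne'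
    hγ hloc
  refine key ?_
  simpa only [Complex.ofReal_zero] using lt_of_le_of_lt h1 h2

/-- **T17, effective.** The double-log window with the definite offset `doubleLogC0 ψ η`. -/
theorem weilGroundEnergy_neg_of_local_doubleLog_eff (hψ : ContDiff ℝ ∞ ψ)
    (hsupp : tsupport ψ ⊆ Icc (-1) 1) (hψ0 : ∀ s, 0 ≤ ψ s) {η : ℝ} (hη : 0 < η)
    (hη2 : η < 1 / 2) (hΦ : 0 < bumpLaplace ψ η) :
    ∀ (γ₀ c R : ℝ), 1 ≤ |γ₀| →
      doubleLogC0 ψ η + Real.log (Real.log (|γ₀| + 2)) / (2 * η) ≤ c → 1 ≤ R →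
      Real.exp (c + 1) ≤ R ^ 2 →
      riemannZeta (1 / 2 + η + γ₀ * I) = 0 →
      (∀ ρ : ℂ, riemannZeta ρ = 0 → 0 ≤ ρ.re → ρ.re ≤ 1 → |ρ.im - γ₀| < R → ρ.re ≠ 1 / 2 →
          ρ = 1 / 2 + η + γ₀ * I ∨ ρ = 1 / 2 - η + γ₀ * I) →
      weilGroundEnergy (c + 1) < 0 := by
  intro γ₀ c R hγ hc hR hRa hζ hloc
  unfold doubleLogC0 at hc
  have hT := weilGroundEnergy_neg_of_local_bumpDipole_eff hψ hsupp hψ0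
  set K : ℝ := bumpK ψ with hK_def
  have hK : 0 < K := hK_def ▸ bumpK_pos ψ
  set Φ : ℝ := bumpLaplace ψ η with hΦ_def
  set Φm : ℝ := bumpLaplace ψ (-η) with hΦm_def
  have hΦm : 0 ≤ Φm := bumpLaplace_nonneg hψ0 (-η)
  set c₁ : ℝ := Real.log (2 * Φm / Φ + 1) / η with hc₁_def
  set c₂ : ℝ := Real.log (4 * K / (η ^ 4 * Φ ^ 2) + 1) / (2 * η) with hc₂_def
  have hq1 : 0 < 2 * Φm / Φ + 1 := by positivity
  have hq2 : 0 < 4 * K / (η ^ 4 * Φ ^ 2) + 1 := by positivity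
  have hc₁ : 0 ≤ c₁ :=
    div_nonneg (Real.log_nonneg (le_add_of_nonneg_left (by positivity))) hη.le
  have hγ0 : γ₀ ≠ 0 := by intro h; rw [h, abs_zero] at hγ; linarith
  have hL : 1 < Real.log (|γ₀| + 2) := by
    rw [Real.lt_log_iff_exp_lt (by positivity)]
    linarith [Real.exp_one_lt_d9]
  have hL0 : 0 < Real.log (|γ₀| + 2) := by linarith
  have hlogL : 0 < Real.log (Real.log (|γ₀| + 2)) := Real.log_pos hL
  have h2η : 0 < 2 * η := by linarith
  have hcc₁ : c₁ ≤ c := by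
    have : 0 ≤ Real.log (Real.log (|γ₀| + 2)) / (2 * η) := by positivity
    linarith [le_max_left c₁ c₂]
  have hcc₂ : c₂ + Real.log (Real.log (|γ₀| + 2)) / (2 * η) ≤ c := by
    linarith [le_max_right c₁ c₂]
  have hc0 : 0 ≤ c := hc₁.trans hcc₁
  -- (i) the reflected mass is dominated: `2Φ(−η) < e^{ηc} Φ(η)`
  have e1 : Real.exp (η * c₁) = 2 * Φm / Φ + 1 := by
    rw [show η * c₁ = Real.log (2 * Φm / Φ + 1) by rw [hc₁_def]; field_simp, Real.exp_log hq1]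
  have i1 : 2 * Φm / Φ + 1 ≤ Real.exp (η * c) :=
    e1 ▸ Real.exp_le_exp.mpr (mul_le_mul_of_nonneg_left hcc₁ hη.le)
  have i1' : 2 * Φm + Φ ≤ Real.exp (η * c) * Φ := by
    have := mul_le_mul_of_nonneg_right i1 hΦ.le
    rwa [add_mul, one_mul, div_mul_cancel₀ _ hΦ.ne'] at this
  have hdom : Φm ≤ Real.exp (η * c) * Φ := by linarith
  -- (ii) the height condition: `(4K/(η⁴Φ²) + 1)·log(|γ₀|+2) ≤ e^{2ηc}`
  have e2 : Real.exp (2 * η * c₂) = 4 * K / (η ^ 4 * Φ ^ 2) + 1 := by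
    rw [show 2 * η * c₂ = Real.log (4 * K / (η ^ 4 * Φ ^ 2) + 1) by rw [hc₂_def]; field_simp,
      Real.exp_log hq2]
  have i2 : (4 * K / (η ^ 4 * Φ ^ 2) + 1) * Real.log (|γ₀| + 2) ≤ Real.exp (2 * η * c) := by
    have step : 2 * η * c₂ + Real.log (Real.log (|γ₀| + 2)) ≤ 2 * η * c := by
      have hne : η ≠ 0 := hη.ne'
      have e3 : 2 * η * (c₂ + Real.log (Real.log (|γ₀| + 2)) / (2 * η)) =
          2 * η * c₂ + Real.log (Real.log (|γ₀| + 2)) := by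
        field_simp
      have := mul_le_mul_of_nonneg_left hcc₂ h2η.le
      linarith [e3]
    calc (4 * K / (η ^ 4 * Φ ^ 2) + 1) * Real.log (|γ₀| + 2)
        = Real.exp (2 * η * c₂ + Real.log (Real.log (|γ₀| + 2))) := by
          rw [Real.exp_add, e2, Real.exp_log hL0]
      _ ≤ Real.exp (2 * η * c) := Real.exp_le_exp.mpr step
  have hpos : 0 < η ^ 4 * Φ ^ 2 := by positivity
  have i2' : 4 * K * Real.log (|γ₀| + 2) < η ^ 4 * Φ ^ 2 * Real.exp (2 * η * c) := by
    have h := mul_le_mul_of_nonneg_left i2 hpos.le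
    have expand : η ^ 4 * Φ ^ 2 * ((4 * K / (η ^ 4 * Φ ^ 2) + 1) * Real.log (|γ₀| + 2)) =
        4 * K * Real.log (|γ₀| + 2) + η ^ 4 * Φ ^ 2 * Real.log (|γ₀| + 2) := by
      field_simp
    rw [expand] at h
    have : 0 < η ^ 4 * Φ ^ 2 * Real.log (|γ₀| + 2) := by positivity
    linarith
  -- the gain
  set g : ℝ := Real.exp (η * c) * Φ - Φm with hg_def
  have hg : Real.exp (η * c) * Φ / 2 ≤ g := by rw [hg_def]; linarith
  have hg0 : 0 ≤ Real.exp (η * c) * Φ / 2 := by positivity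
  have hg2 : Real.exp (2 * η * c) * Φ ^ 2 / 4 ≤ g ^ 2 := by
    have h := pow_le_pow_left₀ hg0 hg 2
    have e : (Real.exp (η * c) * Φ / 2) ^ 2 = Real.exp (2 * η * c) * Φ ^ 2 / 4 := by
      rw [div_pow, mul_pow, sq (Real.exp _), ← Real.exp_add]; ring_nf
    rwa [e] at h
  have hwin : K * Real.log (|γ₀| + 2) < η ^ 4 * g ^ 2 := by
    have := mul_le_mul_of_nonneg_left hg2 (by positivity : (0 : ℝ) ≤ η ^ 4)
    linarith
  exact hT η γ₀ c R hη hη2 hγ0 hc0 hR hRa hζ hloc hdom hwin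

end Summit.RiemannHypothesis.RiemannHypothesis.Theorems
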